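import Literature.NumberTheory.Sieve.PolymathSieveAsymptotics
import Literature.NumberTheory.Sieve.MaynardSieveTuples
import Mathlib.Analysis.SpecialFunctions.Pow.Asymptotics
import HarnessLib

/-!
# Polymath 8b, Lemma 4.1 (the key asymptotic, case `N = 1`) and Theorem 3.6(i) deduced from it

Trunk: AntSieve / parity.S13.  Fourth layer of the decomposition of the named fact
`Literature.NumberTheory.Sieve.frequently_nth_prime_succ_le_add_polymath` (`H₁ ≤ 246`; D. H. J. Polymath, *Variants of the
Selberg sieve, and bounded intervals containing many primes*, Res. Math. Sci. 1:12 (2014) =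
arXiv:1407.4897, Theorem 1.4(i)).  `PolymathSieveAsymptotics.lean` leaves the sieve asymptotics
Theorem 3.5(i) and Theorem 3.6(i) (`divisorSumWeights_asymptotic`) as named facts; both are proved in
§4 of the paper from one "key asymptotic", Lemma 4.1.  This file

* vendors **Lemma 4.1** (p. 12 of the arXiv version) in the case `N = 1` (the only case used for
  Theorems 3.5(i)/3.6(i)) as the named fact `moebiusLcmSums_asymptotic`, with the finite sum
  `lcmSum` (the left side of (multisum)) and its summation condition `LcmCoprime`
  ("`[d_1,d'_1], …, [d_k,d'_k], W` coprime");
* PROVES **Theorem 3.6(i)** from it (`divisorSumWeights_asymptotic_of_lcmSums`), following §4.1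
  ("The trivial case", p. 13): expansion of the divisor sums, the count of an arithmetic progression
  by the Chinese remainder theorem (`abs_card_filter_dvd_sub_le`, using the CRT bookkeeping of
  `MaynardSieveTuples.lean`), the vanishing of the inadmissible terms
  (`not_forall_lcm_dvd_of_not_lcmCoprime`: `b + hᵢ` coprime to `W`, `|hᵢ - h_j| < w`), and the bound
  `O(x^{∑ (S(Fᵢ)+S(Gᵢ))}) = o(B^{-k} x/W)` for the `O(1)` errors (`W ≤ log² x`,
  `eventually_polymathW_le_log_sq`; `B ≤ log x`).

Conventions (asymptotic notation, cutoffs `IsSieveCutoff`, `W`, `B`, the range `polymathRange`) are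
those of `PolymathSieveAsymptotics.lean` (module docstring there).  Lemma 4.1 itself (Fourier
expansion of `e^t F_j(t)`, Euler products, the simple pole of `ζ` at `1`) is NOT proved in this file.

## References

* D. H. J. Polymath, *Variants of the Selberg sieve, and bounded intervals containing many primes*,
  Res. Math. Sci. 1 (2014), Art. 12; arXiv:1407.4897, Lemma 4.1 (p. 12) and §4.1 (p. 13).
  [Polymath8b2014]
-/

noncomputable section

open MeasureTheory Filter Finset Asymptotics
open scoped BigOperators Topology ArithmeticFunction.Moebius

namespace Literature.NumberTheory.Sieve

section Defs

variable {ι : Type*}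

/-- The box `[1, D]^ι` of tuples `(d_j)_{j ∈ ι}` of positive integers `≤ D`. [folklore] -/
def lcmBox (ι : Type*) [Fintype ι] [DecidableEq ι] (D : ℕ) : Finset (ι → ℕ) :=
  Fintype.piFinset fun _ => Finset.Icc 1 D

/-- The summation condition of (multisum) in Polymath 8b Lemma 4.1 (with `N = 1`):
"`[d_1,d'_1], …, [d_k,d'_k], W` coprime", i.e. the `[d_j, d'_j]` are coprime to each other and to `W`.
[cite: Polymath8b2014, Lemma 4.1] -/
def LcmCoprime (W : ℕ) (d d' : ι → ℕ) : Prop :=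
  (∀ i j, i ≠ j → Nat.Coprime (Nat.lcm (d i) (d' i)) (Nat.lcm (d j) (d' j))) ∧
    ∀ j, Nat.Coprime (Nat.lcm (d j) (d' j)) W

/-- The coprimality condition is decidable (it is a finite conjunction of `gcd = 1` conditions), so
that it can be used as the condition of an `if` in `lcmSum`. [folklore] -/
instance [Fintype ι] [DecidableEq ι] (W : ℕ) (d d' : ι → ℕ) : Decidable (LcmCoprime W d d') := by
  unfold LcmCoprime; infer_instance

/-- The summand `∏_j μ(d_j) μ(d'_j) F_j(log_x d_j) G_j(log_x d'_j) / [d_j, d'_j]` of (multisum),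
`log_x d := log d / log x`. [cite: Polymath8b2014, Lemma 4.1] -/
def lcmTerm [Fintype ι] (F G : ι → ℝ → ℝ) (x : ℝ) (d d' : ι → ℕ) : ℝ :=
  ∏ j, (μ (d j) : ℝ) * μ (d' j) * F j (Real.log (d j) / Real.log x) *
    G j (Real.log (d' j) / Real.log x) / Nat.lcm (d j) (d' j)

/-- The left-hand side of (multisum) (Polymath 8b Lemma 4.1, `N = 1`), with the variables `d_j, d'_j`
ranging over `[1, D]`:
`∑_{d, d' ∈ [1,D]^ι : [d_j,d'_j] coprime to each other and to W} ∏_j μ(d_j)μ(d'_j)F_j(log_x d_j)G_j(log_x d'_j)/[d_j,d'_j]`.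
In the lemma the sum is over all `d_j, d'_j ≥ 1`; as the `F_j, G_j` are compactly supported only
`d_j, d'_j ≤ x^T` contribute (`T` bounding the supports), so `D = ⌊x^T⌋` gives the printed sum.
[cite: Polymath8b2014, Lemma 4.1] -/
def lcmSum [Fintype ι] [DecidableEq ι] (W : ℕ) (F G : ι → ℝ → ℝ) (x : ℝ) (D : ℕ) : ℝ :=
  ∑ d ∈ lcmBox ι D, ∑ d' ∈ lcmBox ι D, if LcmCoprime W d d' then lcmTerm F G x d d' else 0

end Defs

/-- **Polymath 8b, Lemma 4.1 (Asymptotic), case `N = 1`.**  Let `k ≥ 1` be fixed and let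
`F_1, …, F_k, G_1, …, G_k : [0,+∞) → ℝ` be fixed smooth compactly supported functions.  Then
`∑_{d_1,…,d_k,d'_1,…,d'_k : [d_1,d'_1],…,[d_k,d'_k], W coprime} ∏_{j=1}^k μ(d_j)μ(d'_j)F_j(log_x d_j)G_j(log_x d'_j)/[d_j,d'_j]
  = (c + o(1)) B^{-k}`, where `B = (φ(W)/W) log x` ((bnorm), `polymathB`) and
`c := ∏_{j=1}^k ∫_0^∞ F_j'(t) G_j'(t) dt`.
(The printed lemma allows an extra natural number `N` coprime to `W` with `log N = O(log^{O(1)} x)`,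
the sum then also requiring coprimality with `N` and the right side carrying `N^k/φ(N)^k`, and a variant
with `φ([d_j,d'_j])` in place of `[d_j,d'_j]`; only the case `N = 1` stated here is used for Theorems
3.5(i) and 3.6(i).)  Rendering: the index set `{1,…,k}` is a finite type `ι` with `k = |ι|`; the
cutoffs are `IsSieveCutoff (F j) (sF j)` (smooth on `ℝ`, vanishing beyond `sF j`, module docstring of
`PolymathSieveAsymptotics.lean`) and `T` is any fixed common bound for the `sF j, sG j`, so that the
finite sum `lcmSum (W x) F G x ⌊x^T⌋₊` is the printed sum; "`= (c + o(1)) B^{-k}`" is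
"`(· - c B^{-k}) =o[atTop] B^{-k}`" (Definition 1.6).  Proved in the paper by Fourier expansion of
`e^t F_j(t)`, Euler products and the simple pole of `ζ` at `s = 1`; NOT proved in this file.
[cite: Polymath8b2014, Lemma 4.1] -/
def moebiusLcmSums_asymptotic : Prop :=
  ∀ (ι : Type) [Fintype ι] [DecidableEq ι], 1 ≤ Fintype.card ι →
  ∀ (F G : ι → ℝ → ℝ) (sF sG : ι → ℝ),
    (∀ j, IsSieveCutoff (F j) (sF j)) → (∀ j, IsSieveCutoff (G j) (sG j)) →
  ∀ (T : ℝ), (∀ j, sF j ≤ T) → (∀ j, sG j ≤ T) →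
    (fun x : ℝ => lcmSum (polymathW x) F G x ⌊x ^ T⌋₊ -
        (∏ j, ∫ t in Set.Ioi (0 : ℝ), deriv (F j) t * deriv (G j) t) *
          (polymathB x ^ Fintype.card ι)⁻¹)
      =o[atTop] fun x : ℝ => (polymathB x ^ Fintype.card ι)⁻¹


/-! ### Elementary lemmas for the proof of Theorem 3.6(i) (§4.1) -/

section Glue

variable {κ : Type*} [Fintype κ] [DecidableEq κ]

/-- `λ_F(m) = ∑_{e ≤ D, e ∣ m} μ(e) F(log_x e)` as soon as `F(log_x e) = 0` for `e > D` (used with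
`D = ⌊x⌋`: `S(F) < 1` kills the divisors `e > x`). [cite: Polymath8b2014, §4.1 (expansion of (lflg) by (lambdaf-def))] -/
theorem divisorSumWeight_eq_sum_Icc (F : ℝ → ℝ) (x : ℝ) {D m : ℕ} (hm : m ≠ 0)
    (hvan : ∀ e : ℕ, D < e → F (Real.log e / Real.log x) = 0) :
    divisorSumWeight F x m =
      ∑ e ∈ Finset.Icc 1 D, if e ∣ m then (μ e : ℝ) * F (Real.log e / Real.log x) else 0 := by
  rw [divisorSumWeight, ← Finset.sum_filter]
  symm
  apply Finset.sum_subset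
  · intro e he
    simp only [Finset.mem_filter, Finset.mem_Icc] at he
    exact Nat.mem_divisors.2 ⟨he.2, hm⟩
  · intro e he hne
    have he' := Nat.mem_divisors.1 he
    have hpos : 1 ≤ e := Nat.pos_of_dvd_of_pos he'.1 (Nat.pos_of_ne_zero hm)
    have hD : D < e := by
      by_contra hle
      exact hne (Finset.mem_filter.2 ⟨Finset.mem_Icc.2 ⟨hpos, not_lt.1 hle⟩, he'.1⟩)
    rw [hvan e hD, mul_zero]

/-- Expanding `∏ᵢ λ_{Fᵢ}(mᵢ) λ_{Gᵢ}(mᵢ)` into a sum over `d_1,…,d_k,d'_1,…,d'_k` with the condition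
`[dᵢ, d'ᵢ] ∣ mᵢ` (Polymath 8b, §4.1, display (lflg-expand)). [cite: Polymath8b2014, §4.1] -/
theorem prod_sum_ite_dvd_mul_sum_ite_dvd (s : Finset ℕ) (a b : κ → ℕ → ℝ) (m : κ → ℕ) :
    ∏ i, ((∑ e ∈ s, if e ∣ m i then a i e else 0) * ∑ e ∈ s, if e ∣ m i then b i e else 0) =
      ∑ d ∈ Fintype.piFinset (fun _ : κ => s), ∑ d' ∈ Fintype.piFinset (fun _ : κ => s),
        if ∀ i, Nat.lcm (d i) (d' i) ∣ m i then ∏ i, (a i (d i) * b i (d' i)) else 0 := by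
  have h1 : ∀ i, ((∑ e ∈ s, if e ∣ m i then a i e else 0) * ∑ e ∈ s, if e ∣ m i then b i e else 0) =
      ∑ e ∈ s, ∑ e' ∈ s, if Nat.lcm e e' ∣ m i then a i e * b i e' else 0 := by
    intro i
    rw [Finset.sum_mul_sum]
    refine Finset.sum_congr rfl fun e _ => Finset.sum_congr rfl fun e' _ => ?_
    by_cases he : e ∣ m i <;> by_cases he' : e' ∣ m i <;> simp [he, he', Nat.lcm_dvd_iff]
  simp_rw [h1]
  rw [Finset.prod_univ_sum]
  refine Finset.sum_congr rfl fun d _ => ?_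
  rw [Finset.prod_univ_sum]
  refine Finset.sum_congr rfl fun d' _ => ?_
  rw [Fintype.prod_ite_zero]

/-- `∑_{d, d'} ∏ᵢ |aᵢ(dᵢ)| |bᵢ(d'ᵢ)| = ∏ᵢ (∑_e |aᵢ(e)|) · ∏ᵢ (∑_e |bᵢ(e)|)`. [folklore] -/
theorem sum_sum_prod_abs_mul_abs (s : Finset ℕ) (a b : κ → ℕ → ℝ) :
    ∑ d ∈ Fintype.piFinset (fun _ : κ => s), ∑ d' ∈ Fintype.piFinset (fun _ : κ => s),
        ∏ i, (|a i (d i)| * |b i (d' i)|) =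
      (∏ i, ∑ e ∈ s, |a i e|) * ∏ i, ∑ e ∈ s, |b i e| := by
  rw [Finset.prod_univ_sum, Finset.prod_univ_sum, Finset.sum_mul_sum]
  refine Finset.sum_congr rfl fun d _ => Finset.sum_congr rfl fun d' _ => ?_
  rw [Finset.prod_mul_distrib]

/-- Chinese remainder theorem for the moduli `W, q_i` (`i ∈ s`), pairwise coprime: the congruences
`n ≡ v (W)`, `n ≡ cᵢ (qᵢ)` are one congruence modulo `W ∏ qᵢ` (Polymath 8b, §4.1: "summing the
constant function 1 over an arithmetic progression … of spacing `W [d_1,d'_1] ⋯ [d_k,d'_k]`").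
[cite: Polymath8b2014, §4.1] -/
theorem exists_forall_modEq_iff_modEq_prod (s : Finset κ) (W : ℕ) (q : κ → ℕ) (c : κ → ℤ) (v : ℤ)
    (hqW : ∀ i ∈ s, Nat.Coprime (q i) W)
    (hq : ∀ i ∈ s, ∀ j ∈ s, i ≠ j → Nat.Coprime (q i) (q j)) :
    ∃ a : ℤ, ∀ n : ℤ, (n ≡ v [ZMOD W] ∧ ∀ i ∈ s, n ≡ c i [ZMOD q i]) ↔
      n ≡ a [ZMOD ((W * ∏ i ∈ s, q i : ℕ) : ℤ)] := by
  induction s using Finset.induction_on with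
  | empty => exact ⟨v, fun n => by simp⟩
  | insert j s hj ih =>
    obtain ⟨a', ha'⟩ := ih (fun i hi => hqW i (Finset.mem_insert_of_mem hi))
      (fun i hi i' hi' hne => hq i (Finset.mem_insert_of_mem hi) i' (Finset.mem_insert_of_mem hi') hne)
    have hcop : (W * ∏ i ∈ s, q i).Coprime (q j) := by
      refine Nat.Coprime.mul_left (hqW j (Finset.mem_insert_self j s)).symm ?_
      exact Nat.Coprime.prod_left fun i hi => hq i (Finset.mem_insert_of_mem hi) j
        (Finset.mem_insert_self j s) (fun h => hj (h ▸ hi))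
    have hcop' : ((W * ∏ i ∈ s, q i : ℕ) : ℤ).natAbs.Coprime ((q j : ℕ) : ℤ).natAbs := by
      simpa only [Int.natAbs_natCast] using hcop
    obtain ⟨a, ha⟩ := MaynardTao.exists_modEq_and_modEq_iff hcop' a' (c j)
    refine ⟨a, fun n => ?_⟩
    rw [Finset.prod_insert hj, Finset.forall_mem_insert,
      show W * (q j * ∏ i ∈ s, q i) = (W * ∏ i ∈ s, q i) * q j by ring]
    have ha_n := ha n
    have ha'_n := ha' n
    push_cast at ha_n ha'_n ⊢
    rw [← ha_n, ← ha'_n]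
    tauto

/-- `⌈x⌉ ≤ ⌊2x⌋ + 1` for `x ≥ 0`. [folklore] -/
theorem natCeil_le_natFloor_two_mul_add_one {x : ℝ} (hx : 0 ≤ x) : ⌈x⌉₊ ≤ ⌊2 * x⌋₊ + 1 := by
  have h1 : (⌈x⌉₊ : ℝ) < x + 1 := Nat.ceil_lt_add_one hx
  have h2 : (2 * x : ℝ) < ⌊2 * x⌋₊ + 1 := Nat.lt_floor_add_one _
  have h3 : (⌈x⌉₊ : ℝ) < ((⌊2 * x⌋₊ + 1 + 1 : ℕ) : ℝ) := by push_cast; linarith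
  have h4 : ⌈x⌉₊ < ⌊2 * x⌋₊ + 1 + 1 := by exact_mod_cast h3
  omega

/-- The natural numbers `n ∈ [⌈x⌉, ⌊2x⌋]` in a residue class, transported to `ℤ`. [folklore] -/
theorem image_natCast_filter_Icc_modEq (A B : ℕ) (a M : ℤ) :
    ((Finset.Icc A B).filter fun n : ℕ => (n : ℤ) ≡ a [ZMOD M]).image (fun n : ℕ => (n : ℤ)) =
      (Finset.Ico (A : ℤ) (B + 1)).filter fun z => z ≡ a [ZMOD M] := by
  ext z
  simp only [Finset.mem_image, Finset.mem_filter, Finset.mem_Icc, Finset.mem_Ico]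
  constructor
  · rintro ⟨n, ⟨⟨hA, hB⟩, hmod⟩, rfl⟩
    exact ⟨⟨by exact_mod_cast hA, by exact_mod_cast Nat.lt_succ_of_le hB⟩, hmod⟩
  · rintro ⟨⟨hA, hB⟩, hmod⟩
    have hz : 0 ≤ z := le_trans (by positivity) hA
    refine ⟨z.toNat, ⟨⟨?_, ?_⟩, ?_⟩, Int.toNat_of_nonneg hz⟩
    · have : (A : ℤ) ≤ z.toNat := by rw [Int.toNat_of_nonneg hz]; exact hA
      exact_mod_cast this
    · have h' : (z.toNat : ℤ) < B + 1 := by rw [Int.toNat_of_nonneg hz]; exact hB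
      have : z.toNat < B + 1 := by exact_mod_cast h'
      omega
    · rw [Int.toNat_of_nonneg hz]; exact hmod

/-- A residue class modulo `M` meets `{⌈x⌉ ≤ n ≤ ⌊2x⌋}` in `x/M + O(1)` integers
(Polymath 8b, §4.1: "`S = x/(W[d_1,d'_1]⋯[d_k,d'_k]) + O(1)`"). [cite: Polymath8b2014, §4.1] -/
theorem abs_card_filter_Icc_modEq_sub_le {x : ℝ} (hx : 0 ≤ x) {M : ℕ} (hM : 0 < M) (a : ℤ) :
    |(#((Finset.Icc ⌈x⌉₊ ⌊2 * x⌋₊).filter fun n : ℕ => (n : ℤ) ≡ a [ZMOD M]) : ℝ) - x / M| ≤ 3 := by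
  set A := ⌈x⌉₊ with hAdef
  set Bn := ⌊2 * x⌋₊ with hBdef
  have hcard : #((Finset.Icc A Bn).filter fun n : ℕ => (n : ℤ) ≡ a [ZMOD M]) =
      #((Finset.Ico (A : ℤ) (Bn + 1)).filter fun z => z ≡ a [ZMOD M]) := by
    rw [← image_natCast_filter_Icc_modEq, Finset.card_image_of_injective _ Nat.cast_injective]
  have hAB : (A : ℤ) ≤ (Bn : ℤ) + 1 := by
    exact_mod_cast natCeil_le_natFloor_two_mul_add_one hx
  have hM' : (0 : ℤ) < (M : ℤ) := by exact_mod_cast hM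
  have h1 := MaynardTao.abs_card_filter_modEq_sub_le (A : ℤ) ((Bn : ℤ) + 1) a hAB hM'
  have hA1 : (A : ℝ) < x + 1 := Nat.ceil_lt_add_one hx
  have hA2 : x ≤ (A : ℝ) := Nat.le_ceil x
  have hB1 : (Bn : ℝ) ≤ 2 * x := Nat.floor_le (by linarith)
  have hB2 : 2 * x < (Bn : ℝ) + 1 := Nat.lt_floor_add_one _
  have hMr : (1 : ℝ) ≤ M := by exact_mod_cast hM
  have hMpos : (0 : ℝ) < M := by linarith
  have h2 : |(((Bn : ℤ) + 1 : ℤ) : ℝ) - ((A : ℤ) : ℝ) - x| ≤ 2 := by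
    rw [abs_le]; push_cast; constructor <;> linarith
  have h1' : |(#((Finset.Ico (A : ℤ) (Bn + 1)).filter fun z => z ≡ a [ZMOD M]) : ℝ) -
      ((((Bn : ℤ) + 1 : ℤ) : ℝ) - ((A : ℤ) : ℝ)) / M| ≤ 1 := by
    convert h1 using 3; push_cast; ring
  rw [hcard]
  have h3 : |((((Bn : ℤ) + 1 : ℤ) : ℝ) - ((A : ℤ) : ℝ)) / M - x / M| ≤ 2 := by
    rw [← sub_div, abs_div, abs_of_pos hMpos]
    calc |(((Bn : ℤ) + 1 : ℤ) : ℝ) - ((A : ℤ) : ℝ) - x| / M ≤ 2 / M := by gcongr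
      _ ≤ 2 / 1 := by gcongr
      _ = 2 := by norm_num
  calc _ ≤ |(#((Finset.Ico (A : ℤ) (Bn + 1)).filter fun z => z ≡ a [ZMOD M]) : ℝ) -
          ((((Bn : ℤ) + 1 : ℤ) : ℝ) - ((A : ℤ) : ℝ)) / M| +
        |((((Bn : ℤ) + 1 : ℤ) : ℝ) - ((A : ℤ) : ℝ)) / M - x / M| := abs_sub_le _ _ _
    _ ≤ 1 + 2 := add_le_add h1' h3
    _ = 3 := by norm_num

/-- **The count `S(d_1,…,d'_k)` of §4.1, admissible case**: if the `Lᵢ = [dᵢ,d'ᵢ]` are coprime to each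
other and to `W`, then `#{x ≤ n ≤ 2x : n = b (W), n + hᵢ = 0 (Lᵢ) ∀ i} = x/(W ∏ Lᵢ) + O(1)`
(here `|O(1)| ≤ 3`). [cite: Polymath8b2014, §4.1] -/
theorem abs_card_filter_dvd_sub_le {x : ℝ} (hx : 0 ≤ x) {W : ℕ} (hW : 0 < W) (b : ℤ) (h : κ → ℤ)
    {L : κ → ℕ} (hL : ∀ i, 0 < L i) (hLW : ∀ i, Nat.Coprime (L i) W)
    (hLL : ∀ i j, i ≠ j → Nat.Coprime (L i) (L j)) :
    |(#(((Finset.Icc ⌈x⌉₊ ⌊2 * x⌋₊).filter fun n : ℕ => (n : ℤ) ≡ b [ZMOD W]).filter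
        fun n : ℕ => ∀ i, ((L i : ℕ) : ℤ) ∣ (n : ℤ) + h i) : ℝ) - x / (W * ∏ i, (L i : ℝ))| ≤ 3 := by
  obtain ⟨a, ha⟩ := exists_forall_modEq_iff_modEq_prod (Finset.univ : Finset κ) W L
    (fun i => -h i) b (fun i _ => hLW i) (fun i _ j _ hij => hLL i j hij)
  have hM : 0 < W * ∏ i, L i := Nat.mul_pos hW (Finset.prod_pos fun i _ => hL i)
  have key := abs_card_filter_Icc_modEq_sub_le hx hM a
  rw [Finset.filter_filter]
  have hset : ((Finset.Icc ⌈x⌉₊ ⌊2 * x⌋₊).filter fun n : ℕ =>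
      ((n : ℤ) ≡ b [ZMOD W]) ∧ ∀ i, ((L i : ℕ) : ℤ) ∣ (n : ℤ) + h i) =
      (Finset.Icc ⌈x⌉₊ ⌊2 * x⌋₊).filter fun n : ℕ =>
        (n : ℤ) ≡ a [ZMOD ((W * ∏ i, L i : ℕ) : ℤ)] := by
    refine Finset.filter_congr fun n _ => ?_
    rw [← ha n]
    simp only [Finset.mem_univ, forall_true_left]
    refine and_congr_right fun _ => forall_congr' fun i => ?_
    rw [Int.modEq_iff_dvd, show -h i - (n : ℤ) = -((n : ℤ) + h i) by ring, dvd_neg]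
  rw [hset]
  have e : ((W * ∏ i, L i : ℕ) : ℝ) = (W : ℝ) * ∏ i, (L i : ℝ) := by push_cast; ring
  rw [← e]
  exact key

omit [Fintype κ] [DecidableEq κ] in
/-- **The count of §4.1, inadmissible case**: "`b + hᵢ` is coprime to `W` for all `i`, and
`|hᵢ - h_j| < w` for all distinct `i, j`.  Thus `S(d_1,…,d'_k)` vanishes unless the `[dᵢ,d'ᵢ]` are
coprime to each other and to `W`."  Here the second hypothesis is rendered as: every prime dividing
some `hᵢ - h_j` (`i ≠ j`) divides `W`. [cite: Polymath8b2014, §4.1] -/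
theorem not_forall_lcm_dvd_of_not_lcmCoprime {W : ℕ} {d d' : κ → ℕ} (hnot : ¬ LcmCoprime W d d')
    (h : κ → ℤ) (b : ℤ) (hb : ∀ i, Int.gcd (b + h i) W = 1)
    (hprime : ∀ p : ℕ, p.Prime → ∀ i j, i ≠ j → (p : ℤ) ∣ h i - h j → p ∣ W)
    {n : ℤ} (hn : n ≡ b [ZMOD W]) :
    ¬ ∀ i, ((Nat.lcm (d i) (d' i) : ℕ) : ℤ) ∣ n + h i := by
  intro hdiv
  have key : ∀ p : ℕ, p.Prime → ∀ i, p ∣ Nat.lcm (d i) (d' i) → p ∣ W → False := by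
    intro p hp i hpi hpW
    have h1 : (p : ℤ) ∣ n + h i := (Int.natCast_dvd_natCast.2 hpi).trans (hdiv i)
    have h2 : (p : ℤ) ∣ n - b := (Int.natCast_dvd_natCast.2 hpW).trans hn.symm.dvd
    have h3 : (p : ℤ) ∣ b + h i := by
      have e : b + h i = (n + h i) - (n - b) := by ring
      rw [e]; exact dvd_sub h1 h2
    have h4 : (p : ℤ) ∣ (Int.gcd (b + h i) W : ℤ) :=
      Int.dvd_coe_gcd h3 (Int.natCast_dvd_natCast.2 hpW)
    rw [hb i] at h4
    have h5 : p ∣ 1 := by exact_mod_cast h4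
    exact hp.one_lt.ne' (Nat.dvd_one.1 h5)
  unfold LcmCoprime at hnot
  rw [not_and_or] at hnot
  rcases hnot with hA | hB
  · push Not at hA
    obtain ⟨i, j, hij, hc⟩ := hA
    obtain ⟨p, hp, hpi, hpj⟩ := Nat.Prime.not_coprime_iff_dvd.1 hc
    have h1 : (p : ℤ) ∣ n + h i := (Int.natCast_dvd_natCast.2 hpi).trans (hdiv i)
    have h2 : (p : ℤ) ∣ n + h j := (Int.natCast_dvd_natCast.2 hpj).trans (hdiv j)
    have h3 : (p : ℤ) ∣ h i - h j := by
      have e : h i - h j = (n + h i) - (n + h j) := by ring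
      rw [e]; exact dvd_sub h1 h2
    exact key p hp i hpi (hprime p hp i j hij h3)
  · push Not at hB
    obtain ⟨j, hc⟩ := hB
    obtain ⟨p, hp, hpj, hpW⟩ := Nat.Prime.not_coprime_iff_dvd.1 hc
    exact key p hp j hpj hpW

/-- `∑_{e ≤ D} |μ(e) F(log_x e)| ≤ M x^s` if `|F| ≤ M` on `[0, s]` and `F = 0` beyond `s` (the count of
non-zero terms in §4.1: "for `d_1, …, d'_k` contributing a non-zero term … `[d_1,d'_1]⋯[d_k,d'_k] ≲ x^{1-ε}`";
here simply `dᵢ ≤ x^{S(Fᵢ)}`). [cite: Polymath8b2014, §4.1] -/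
theorem sum_Icc_abs_moebius_mul_le {F : ℝ → ℝ} {s M x : ℝ} (hx : 1 < x) (hM : 0 ≤ M)
    (hFM : ∀ t ∈ Set.Icc 0 s, |F t| ≤ M) (hF0 : ∀ t, s < t → F t = 0) (D : ℕ) :
    ∑ e ∈ Finset.Icc 1 D, |(μ e : ℝ) * F (Real.log e / Real.log x)| ≤ M * x ^ s := by
  have hlog : 0 < Real.log x := Real.log_pos hx
  have hx0 : 0 < x := by linarith
  calc ∑ e ∈ Finset.Icc 1 D, |(μ e : ℝ) * F (Real.log e / Real.log x)|
      ≤ ∑ e ∈ Finset.Icc 1 D, (if e ≤ ⌊x ^ s⌋₊ then M else 0) := by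
        refine Finset.sum_le_sum fun e he => ?_
        have he1 : 1 ≤ e := (Finset.mem_Icc.1 he).1
        have hepos : (0 : ℝ) < e := by exact_mod_cast he1
        split_ifs with hle
        · have hμ : |(μ e : ℝ)| ≤ 1 := by exact_mod_cast ArithmeticFunction.abs_moebius_le_one
          have ht0 : 0 ≤ Real.log e / Real.log x :=
            div_nonneg (Real.log_nonneg (by exact_mod_cast he1)) hlog.le
          have hts : Real.log e / Real.log x ≤ s := by
            rw [div_le_iff₀ hlog]
            have hxs : (e : ℝ) ≤ x ^ s :=
              le_trans (by exact_mod_cast hle) (Nat.floor_le (by positivity))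
            calc Real.log e ≤ Real.log (x ^ s) := Real.log_le_log hepos hxs
              _ = s * Real.log x := Real.log_rpow hx0 s
          rw [abs_mul]
          calc |(μ e : ℝ)| * |F (Real.log e / Real.log x)| ≤ 1 * M :=
                mul_le_mul hμ (hFM _ ⟨ht0, hts⟩) (abs_nonneg _) zero_le_one
            _ = M := one_mul M
        · have hgt : s < Real.log e / Real.log x := by
            rw [lt_div_iff₀ hlog]
            have hxs : x ^ s < e := Nat.lt_of_floor_lt (not_le.1 hle)
            calc s * Real.log x = Real.log (x ^ s) := (Real.log_rpow hx0 s).symm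
              _ < Real.log e := Real.log_lt_log (by positivity) hxs
          rw [hF0 _ hgt, mul_zero, abs_zero]
    _ = M * #((Finset.Icc 1 D).filter fun e => e ≤ ⌊x ^ s⌋₊) := by
        rw [Finset.sum_ite, Finset.sum_const_zero, add_zero, Finset.sum_const, nsmul_eq_mul, mul_comm]
    _ ≤ M * ⌊x ^ s⌋₊ := by
        gcongr
        calc #((Finset.Icc 1 D).filter fun e => e ≤ ⌊x ^ s⌋₊) ≤ #(Finset.Icc 1 ⌊x ^ s⌋₊) :=
              Finset.card_le_card fun e he => by
                simp only [Finset.mem_filter, Finset.mem_Icc] at he ⊢; omega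
          _ = ⌊x ^ s⌋₊ := by simp
    _ ≤ M * x ^ s := by gcongr; exact Nat.floor_le (by positivity)

/-- `w = log log log x → ∞`. [folklore] -/
theorem tendsto_polymathw_atTop : Tendsto polymathw atTop atTop :=
  Real.tendsto_log_atTop.comp (Real.tendsto_log_atTop.comp Real.tendsto_log_atTop)

/-- The crude bound `W ≤ log² x` for large `x` ((W-bound) of Polymath 8b, p. 8: "`W ≪ log log^{O(1)} x`",
from `W ≤ 4^w`). [cite: Polymath8b2014, §3, (W-bound)] -/
theorem eventually_polymathW_le_log_sq : ∀ᶠ x : ℝ in atTop, (polymathW x : ℝ) ≤ Real.log x ^ 2 := by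
  filter_upwards [Real.tendsto_log_atTop.eventually_ge_atTop 1,
    (Real.tendsto_log_atTop.comp Real.tendsto_log_atTop).eventually_ge_atTop 1] with x hlog hll
  have hll' : 1 ≤ Real.log (Real.log x) := hll
  have hlogpos : 0 < Real.log x := by linarith
  have hllpos : 0 < Real.log (Real.log x) := by linarith
  set n := ⌊polymathw x⌋₊ with hn
  have hnle : (n : ℝ) ≤ Real.log (Real.log x) := by
    rcases lt_or_ge (polymathw x) 0 with hw | hw
    · rw [hn, Nat.floor_of_nonpos hw.le, Nat.cast_zero]; linarith
    · calc (n : ℝ) ≤ polymathw x := Nat.floor_le hw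
        _ ≤ Real.log (Real.log x) - 1 := Real.log_le_sub_one_of_pos hllpos
        _ ≤ _ := by linarith
  have h4 : Real.log 4 ≤ 2 := by
    have e : Real.log 4 = 2 * Real.log 2 := by
      rw [show (4 : ℝ) = 2 ^ 2 by norm_num, Real.log_pow]; norm_num
    rw [e]
    have := Real.log_two_lt_d9
    norm_num at this ⊢
    linarith
  calc (polymathW x : ℝ) ≤ ((4 ^ n : ℕ) : ℝ) := by exact_mod_cast primorial_le_four_pow n
    _ = Real.exp (n * Real.log 4) := by
        rw [Real.exp_nat_mul, Real.exp_log (by norm_num)]; push_cast; rfl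
    _ ≤ Real.exp ((2 : ℕ) * Real.log (Real.log x)) := by
        refine Real.exp_le_exp.2 ?_
        push_cast
        nlinarith [Nat.cast_nonneg (α := ℝ) n]
    _ = Real.log x ^ 2 := by rw [Real.exp_nat_mul, Real.exp_log hlogpos]

/-- `B ≤ log x` for `x ≥ 1` (as `φ(W) ≤ W`). [folklore] -/
theorem polymathB_le_log {x : ℝ} (hx : 1 ≤ x) : polymathB x ≤ Real.log x := by
  have hW : (0 : ℝ) < polymathW x := Nat.cast_pos.2 (polymathW_pos x)
  have hφ : (Nat.totient (polymathW x) : ℝ) ≤ polymathW x := by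
    exact_mod_cast Nat.totient_le (polymathW x)
  have hlog : 0 ≤ Real.log x := Real.log_nonneg hx
  calc polymathB x = (Nat.totient (polymathW x) : ℝ) / polymathW x * Real.log x := rfl
    _ ≤ 1 * Real.log x := by
        gcongr
        rwa [div_le_one hW]
    _ = Real.log x := one_mul _

/-- For a cutoff with `S(F) ≤ s`, the derivative vanishes beyond `s`. [folklore] -/
theorem IsSieveCutoff.deriv_eq_zero {F : ℝ → ℝ} {s : ℝ} (hF : IsSieveCutoff F s) {t : ℝ}
    (ht : s < t) : deriv F t = 0 := by
  have h : F =ᶠ[𝓝 t] fun _ => (0 : ℝ) :=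
    (eventually_gt_nhds ht).mono fun u hu => hF.eq_zero u hu
  rw [h.deriv_eq, deriv_const]

/-- `∫_0^∞ F' G' = ∫_0^1 F' G'` when `S(F) ≤ s ≤ 1` ("the restriction of the integrals in (c-def) to
`[0,1]` instead of `[0,+∞)` is harmless since `S(Fᵢ), S(Gᵢ) < 1`", Polymath 8b §4.1).
[cite: Polymath8b2014, §4.1] -/
theorem IsSieveCutoff.setIntegral_Ioi_deriv_mul {F : ℝ → ℝ} {s : ℝ} (hF : IsSieveCutoff F s)
    (hs : s ≤ 1) (g : ℝ → ℝ) :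
    ∫ t in Set.Ioi (0 : ℝ), deriv F t * g t = ∫ t in (0 : ℝ)..1, deriv F t * g t := by
  rw [intervalIntegral.integral_of_le zero_le_one]
  refine setIntegral_eq_of_subset_of_forall_sdiff_eq_zero measurableSet_Ioi
    Set.Ioc_subset_Ioi_self fun t ht => ?_
  have ht1 : 1 < t := by
    rcases ht with ⟨h0, hnot⟩
    by_contra hle
    exact hnot ⟨h0, not_lt.1 hle⟩
  rw [hF.deriv_eq_zero (lt_of_le_of_lt hs ht1), zero_mul]

end Glue


/-! ### Theorem 3.6(i) from Lemma 4.1 (§4.1, "The trivial case") -/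

set_option maxHeartbeats 400000 in
/-- **Polymath 8b, Theorem 3.6(i), deduced from Lemma 4.1** (§4.1 "The trivial case", p. 13 of
arXiv:1407.4897).  Expanding `λ_{Fᵢ}, λ_{Gᵢ}` by (lambdaf-def), the left side of (lflg) is
`∑_{d,d'} (∏ᵢ μ(dᵢ)μ(d'ᵢ)Fᵢ(log_x dᵢ)Gᵢ(log_x d'ᵢ)) S(d,d')` with
`S(d,d') = #{x ≤ n ≤ 2x : n = b (W), n + hᵢ = 0 ([dᵢ,d'ᵢ]) ∀ i}`; since `b + hᵢ` is coprime to `W` and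
`|hᵢ - h_j| < w`, `S` vanishes unless the `[dᵢ,d'ᵢ]` are coprime to each other and to `W`, in which
case `S = x/(W [d_1,d'_1]⋯[d_k,d'_k]) + O(1)` (Chinese remainder theorem); the main term is
`(c + o(1)) B^{-k} x/W` by Lemma 4.1 (`moebiusLcmSums_asymptotic`, with `∫_0^∞ = ∫_0^1` as
`S(Fᵢ), S(Gᵢ) < 1`), and the `O(1)` errors contribute `O(x^{∑ᵢ (S(Fᵢ)+S(Gᵢ))}) = O(x^{1-ε})`, which is
`o(B^{-k} x/W)` as `B ≤ log x`, `W ≤ log² x`.  (The paper bounds the number of non-zero terms through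
the divisor bound; the trivial count `dᵢ ≤ x^{S(Fᵢ)}, d'ᵢ ≤ x^{S(Gᵢ)}` used here suffices.)
[cite: Polymath8b2014, Theorem 3.6(i) (proof, §4.1, p. 13)] -/
theorem divisorSumWeights_asymptotic_of_lcmSums (h41 : moebiusLcmSums_asymptotic) :
    divisorSumWeights_asymptotic := by
  intro H hH hk1 b hb F G sF sG hF hG hsum
  classical
  set k : ℕ := #H with hkdef
  set σ : ℝ := ∑ h ∈ H, (sF h + sG h) with hσdef
  have hσ1 : σ < 1 := hsum
  have hσ0 : 0 ≤ σ := Finset.sum_nonneg fun i hi => add_nonneg (hF i hi).nonneg (hG i hi).nonneg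
  have hsF1 : ∀ h ∈ H, sF h < 1 := fun h hh => by
    have h1 : sF h + sG h ≤ σ := Finset.single_le_sum (f := fun h => sF h + sG h)
      (fun i hi => add_nonneg (hF i hi).nonneg (hG i hi).nonneg) hh
    linarith [(hG h hh).nonneg]
  have hsG1 : ∀ h ∈ H, sG h < 1 := fun h hh => by
    have h1 : sF h + sG h ≤ σ := Finset.single_le_sum (f := fun h => sF h + sG h)
      (fun i hi => add_nonneg (hF i hi).nonneg (hG i hi).nonneg) hh
    linarith [(hF h hh).nonneg]
  -- Lemma 4.1 with `T = 1`, indexed by the finite type `↥H`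
  have h41' := h41 ↥H (by rwa [Fintype.card_coe]) (fun i => F i) (fun i => G i) (fun i => sF i)
    (fun i => sG i) (fun i => hF i i.2) (fun i => hG i i.2) 1 (fun i => (hsF1 i i.2).le)
    (fun i => (hsG1 i i.2).le)
  rw [Fintype.card_coe] at h41'
  -- the constant `c`
  have hc : (∏ i : ↥H, ∫ t in Set.Ioi (0 : ℝ), deriv (F i) t * deriv (G i) t) =
      ∏ h ∈ H, ∫ t in (0 : ℝ)..1, deriv (F h) t * deriv (G h) t := by
    rw [← Finset.prod_coe_sort H]
    exact Finset.prod_congr rfl fun i _ => (hF i i.2).setIntegral_Ioi_deriv_mul (hsF1 i i.2).le _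
  -- a uniform bound `M` for the cutoffs on `[0, 1]`
  obtain ⟨M, hM0, hMF, hMG⟩ : ∃ M : ℝ, 0 ≤ M ∧ (∀ h ∈ H, ∀ t ∈ Set.Icc (0 : ℝ) 1, |F h t| ≤ M) ∧
      (∀ h ∈ H, ∀ t ∈ Set.Icc (0 : ℝ) 1, |G h t| ≤ M) := by
    have hbd : ∀ f : ℝ → ℝ, Continuous f → ∃ C, ∀ t ∈ Set.Icc (0 : ℝ) 1, |f t| ≤ C := fun f hf => by
      obtain ⟨C, hC⟩ := isCompact_Icc.exists_bound_of_continuousOn hf.continuousOn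
      exact ⟨C, fun t ht => by simpa [Real.norm_eq_abs] using hC t ht⟩
    choose CF hCF using fun h : ↥H => hbd (F h) (hF h h.2).contDiff.continuous
    choose CG hCG using fun h : ↥H => hbd (G h) (hG h h.2).contDiff.continuous
    refine ⟨∑ i : ↥H, (|CF i| + |CG i|), Finset.sum_nonneg fun i _ => by positivity, ?_, ?_⟩
    · intro h hh t ht
      have h1 := hCF ⟨h, hh⟩ t ht
      have h2 : |CF ⟨h, hh⟩| + |CG ⟨h, hh⟩| ≤ ∑ i : ↥H, (|CF i| + |CG i|) :=
        Finset.single_le_sum (f := fun i : ↥H => |CF i| + |CG i|) (fun i _ => by positivity)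
          (Finset.mem_univ _)
      linarith [le_abs_self (CF ⟨h, hh⟩), abs_nonneg (CG ⟨h, hh⟩)]
    · intro h hh t ht
      have h1 := hCG ⟨h, hh⟩ t ht
      have h2 : |CF ⟨h, hh⟩| + |CG ⟨h, hh⟩| ≤ ∑ i : ↥H, (|CF i| + |CG i|) :=
        Finset.single_le_sum (f := fun i : ↥H => |CF i| + |CG i|) (fun i _ => by positivity)
          (Finset.mem_univ _)
      linarith [le_abs_self (CG ⟨h, hh⟩), abs_nonneg (CF ⟨h, hh⟩)]
  -- size of the shifts
  set P₀ : ℕ := ∑ h ∈ H, h.natAbs with hP₀def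
  have hP₀ : ∀ h ∈ H, h.natAbs ≤ P₀ := fun h hh =>
    Finset.single_le_sum (f := fun h : ℤ => h.natAbs) (fun _ _ => Nat.zero_le _) hh
  -- the `ε`-argument
  refine Asymptotics.isLittleO_iff.2 fun ε hε => ?_
  have hε2 : 0 < ε / 2 := half_pos hε
  set Cerr : ℝ := 3 * (M ^ k * M ^ k) with hCerr
  have hCerr0 : 0 ≤ Cerr := by positivity
  have hlittle : ∀ᶠ x : ℝ in atTop, Real.log x ^ (k + 2) * (Cerr + 1) ≤ ε / 2 * x ^ (1 - σ) := by
    have hlo := isLittleO_log_rpow_rpow_atTop ((k + 2 : ℕ) : ℝ) (by linarith : 0 < 1 - σ)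
    have hc' : 0 < ε / 2 / (Cerr + 1) := by positivity
    filter_upwards [hlo.def hc', eventually_ge_atTop (1 : ℝ)] with x hx hx1
    rw [Real.norm_of_nonneg (Real.rpow_nonneg (Real.log_nonneg hx1) _),
      Real.norm_of_nonneg (Real.rpow_nonneg (by linarith) _), Real.rpow_natCast] at hx
    have := mul_le_mul_of_nonneg_right hx (by positivity : (0 : ℝ) ≤ Cerr + 1)
    calc Real.log x ^ (k + 2) * (Cerr + 1) ≤ ε / 2 / (Cerr + 1) * x ^ (1 - σ) * (Cerr + 1) := this
      _ = ε / 2 * x ^ (1 - σ) := by field_simp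
  filter_upwards [h41'.def hε2, hlittle, eventually_gt_atTop (1 : ℝ),
    eventually_ge_atTop ((P₀ : ℝ) + 1), eventually_polymathW_le_log_sq,
    (tendsto_nat_floor_atTop.comp tendsto_polymathw_atTop).eventually_ge_atTop (2 * P₀),
    Real.tendsto_log_atTop.eventually_ge_atTop (1 : ℝ)] with x hx41 hxlittle hx1 hxP hxW hxw hxlog
  -- notation and positivity at this `x`
  have hx0 : 0 ≤ x := by linarith
  have hlog : 0 < Real.log x := Real.log_pos hx1
  have hWpos : 0 < polymathW x := polymathW_pos x
  have hW : (0 : ℝ) < polymathW x := Nat.cast_pos.2 hWpos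
  have hB : 0 < polymathB x := polymathB_pos hx1
  have hBk : 0 < polymathB x ^ k := pow_pos hB k
  set W : ℕ := polymathW x with hWdef
  set D : ℕ := ⌊x⌋₊ with hDdef
  set R : Finset ℕ := polymathRange x (b x) with hRdef
  set Mx : ℝ := x / (polymathB x ^ k * W) with hMx
  have hMx0 : 0 < Mx := by positivity
  -- the coefficients `μ(e) Fᵢ(log_x e)`, `μ(e) Gᵢ(log_x e)`
  set a : ↥H → ℕ → ℝ := fun i e => (μ e : ℝ) * F i (Real.log e / Real.log x) with hadef
  set a' : ↥H → ℕ → ℝ := fun i e => (μ e : ℝ) * G i (Real.log e / Real.log x) with ha'def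
  set cc : (↥H → ℕ) → (↥H → ℕ) → ℝ := fun d d' => ∏ i, (a i (d i) * a' i (d' i)) with hccdef
  -- the count `S(d, d')`
  set N : (↥H → ℕ) → (↥H → ℕ) → ℕ := fun d d' =>
    #(R.filter fun n : ℕ => ∀ i : ↥H, ((Nat.lcm (d i) (d' i) : ℕ) : ℤ) ∣ (n : ℤ) + (i : ℤ)) with hNdef
  -- vanishing of the cutoffs beyond `D = ⌊x⌋`
  have hvan : ∀ (f : ℝ → ℝ) (s : ℝ), IsSieveCutoff f s → s < 1 →
      ∀ e : ℕ, D < e → f (Real.log e / Real.log x) = 0 := by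
    intro f s hf hs e he
    apply hf.eq_zero
    have he' : x < e := by
      have : (D : ℝ) + 1 ≤ e := by exact_mod_cast he
      linarith [Nat.lt_floor_add_one x]
    have hepos : (0 : ℝ) < e := by linarith
    rw [lt_div_iff₀ hlog]
    calc s * Real.log x < 1 * Real.log x := by nlinarith
      _ = Real.log x := one_mul _
      _ < Real.log e := Real.log_lt_log (by linarith) he'
  -- members of the range are large
  have hRmem : ∀ n ∈ R, x ≤ n ∧ (n : ℤ) ≡ b x [ZMOD W] := fun n hn =>
    ⟨(le_of_mem_polymathRange hx0 hn).1, (Finset.mem_filter.1 hn).2⟩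
  have hnpos : ∀ n ∈ R, ∀ i : ↥H, 0 < (n : ℤ) + (i : ℤ) := by
    intro n hn i
    have h2 : (P₀ : ℝ) + 1 ≤ n := hxP.trans (hRmem n hn).1
    have h4 : ((P₀ : ℕ) : ℤ) + 1 ≤ n := by exact_mod_cast h2
    have h5 : (i : ℤ).natAbs ≤ P₀ := hP₀ i i.2
    omega
  -- Step 1: expansion of the product of divisor sums, for `n ∈ R`
  have hstep1 : ∀ n ∈ R,
      ∏ h ∈ H, (divisorSumWeight (F h) x ((n : ℤ) + h).toNat *
        divisorSumWeight (G h) x ((n : ℤ) + h).toNat) =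
      ∑ d ∈ lcmBox (↥H) D, ∑ d' ∈ lcmBox (↥H) D,
        if ∀ i : ↥H, ((Nat.lcm (d i) (d' i) : ℕ) : ℤ) ∣ (n : ℤ) + (i : ℤ) then cc d d' else 0 := by
    intro n hn
    set m : ↥H → ℕ := fun i => ((n : ℤ) + (i : ℤ)).toNat with hmdef
    have hmcast : ∀ i : ↥H, ((m i : ℕ) : ℤ) = (n : ℤ) + (i : ℤ) := fun i =>
      Int.toNat_of_nonneg (hnpos n hn i).le
    have hm0 : ∀ i : ↥H, m i ≠ 0 := fun i h0 => by
      have := hmcast i; rw [h0] at this; have := hnpos n hn i; omega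
    rw [← Finset.prod_coe_sort H]
    have h1 : ∀ i : ↥H, divisorSumWeight (F i) x ((n : ℤ) + (i : ℤ)).toNat *
        divisorSumWeight (G i) x ((n : ℤ) + (i : ℤ)).toNat =
        (∑ e ∈ Finset.Icc 1 D, if e ∣ m i then a i e else 0) *
          ∑ e ∈ Finset.Icc 1 D, if e ∣ m i then a' i e else 0 := by
      intro i
      rw [divisorSumWeight_eq_sum_Icc (F i) x (hm0 i) (hvan _ _ (hF i i.2) (hsF1 i i.2)),
        divisorSumWeight_eq_sum_Icc (G i) x (hm0 i) (hvan _ _ (hG i i.2) (hsG1 i i.2))]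
    simp_rw [h1]
    rw [prod_sum_ite_dvd_mul_sum_ite_dvd]
    refine Finset.sum_congr rfl fun d _ => Finset.sum_congr rfl fun d' _ => ?_
    have hiff : (∀ i : ↥H, Nat.lcm (d i) (d' i) ∣ m i) ↔
        ∀ i : ↥H, ((Nat.lcm (d i) (d' i) : ℕ) : ℤ) ∣ (n : ℤ) + (i : ℤ) :=
      forall_congr' fun i => by rw [← hmcast i, Int.natCast_dvd_natCast]
    simp only [hiff, hccdef]
  -- Step 2: interchange of summations
  have hstep2 : ∑ n ∈ R, ∏ h ∈ H, (divisorSumWeight (F h) x ((n : ℤ) + h).toNat *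
        divisorSumWeight (G h) x ((n : ℤ) + h).toNat) =
      ∑ d ∈ lcmBox (↥H) D, ∑ d' ∈ lcmBox (↥H) D, cc d d' * N d d' := by
    rw [Finset.sum_congr rfl hstep1, Finset.sum_comm]
    refine Finset.sum_congr rfl fun d _ => ?_
    rw [Finset.sum_comm]
    refine Finset.sum_congr rfl fun d' _ => ?_
    rw [← Finset.sum_filter, Finset.sum_const, nsmul_eq_mul, mul_comm]
  -- Step 3: the counts
  have hb' : ∀ i : ↥H, Int.gcd (b x + (i : ℤ)) W = 1 := fun i => hb x i i.2
  have hprime : ∀ p : ℕ, p.Prime → ∀ i j : ↥H, i ≠ j → (p : ℤ) ∣ (i : ℤ) - (j : ℤ) → p ∣ W := by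
    intro p hp i j hij hdvd
    have hne : (i : ℤ) - (j : ℤ) ≠ 0 := sub_ne_zero.2 fun h => hij (Subtype.ext h)
    have h1 : p ∣ ((i : ℤ) - (j : ℤ)).natAbs := Int.natCast_dvd.1 hdvd
    have h2 : p ≤ ((i : ℤ) - (j : ℤ)).natAbs := Nat.le_of_dvd (Int.natAbs_pos.2 hne) h1
    have h3 : ((i : ℤ) - (j : ℤ)).natAbs ≤ (i : ℤ).natAbs + (j : ℤ).natAbs :=
      Int.natAbs_sub_le _ _
    have hxw' : 2 * P₀ ≤ ⌊polymathw x⌋₊ := hxw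
    have h4 : p ≤ ⌊polymathw x⌋₊ := by
      have := hP₀ i i.2; have := hP₀ j j.2; omega
    exact (hp.dvd_primorial_iff.2 h4 : p ∣ primorial ⌊polymathw x⌋₊)
  have hNadm : ∀ d ∈ lcmBox (↥H) D, ∀ d' ∈ lcmBox (↥H) D, LcmCoprime W d d' →
      |(N d d' : ℝ) - x / (W * ∏ i, (Nat.lcm (d i) (d' i) : ℝ))| ≤ 3 := by
    intro d hd d' hd' hadm
    have hd1 : ∀ i, 1 ≤ d i := fun i => (Finset.mem_Icc.1 (Fintype.mem_piFinset.1 hd i)).1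
    have hd1' : ∀ i, 1 ≤ d' i := fun i => (Finset.mem_Icc.1 (Fintype.mem_piFinset.1 hd' i)).1
    exact abs_card_filter_dvd_sub_le hx0 hWpos (b x) (fun i : ↥H => (i : ℤ))
      (fun i => Nat.lcm_pos (hd1 i) (hd1' i)) hadm.2 hadm.1
  have hNzero : ∀ d d' : ↥H → ℕ, ¬ LcmCoprime W d d' → N d d' = 0 := by
    intro d d' hnot
    refine Finset.card_eq_zero.2 (Finset.filter_eq_empty_iff.2 fun n hn => ?_)
    exact not_forall_lcm_dvd_of_not_lcmCoprime hnot (fun i : ↥H => (i : ℤ)) (b x) hb' hprime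
      (hRmem n hn).2
  -- Step 4: the main term is `(x/W) · lcmSum`
  have hterm : ∀ d d' : ↥H → ℕ, lcmTerm (fun i : ↥H => F i) (fun i : ↥H => G i) x d d' =
      cc d d' / ∏ i, (Nat.lcm (d i) (d' i) : ℝ) := by
    intro d d'
    rw [hccdef, lcmTerm, ← Finset.prod_div_distrib]
    refine Finset.prod_congr rfl fun i _ => ?_
    simp only [hadef, ha'def]
    ring
  have hmain : x / W * lcmSum W (fun i : ↥H => F i) (fun i : ↥H => G i) x D =
      ∑ d ∈ lcmBox (↥H) D, ∑ d' ∈ lcmBox (↥H) D,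
        if LcmCoprime W d d' then cc d d' * (x / (W * ∏ i, (Nat.lcm (d i) (d' i) : ℝ))) else 0 := by
    rw [lcmSum, Finset.mul_sum]
    refine Finset.sum_congr rfl fun d _ => ?_
    rw [Finset.mul_sum]
    refine Finset.sum_congr rfl fun d' _ => ?_
    split_ifs with hadm
    · rw [hterm]
      field_simp
    · rw [mul_zero]
  -- Step 5: the error term
  have herr : |∑ d ∈ lcmBox (↥H) D, ∑ d' ∈ lcmBox (↥H) D, cc d d' * N d d' -
      x / W * lcmSum W (fun i : ↥H => F i) (fun i : ↥H => G i) x D| ≤ Cerr * x ^ σ := by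
    rw [hmain, ← Finset.sum_sub_distrib]
    simp_rw [← Finset.sum_sub_distrib]
    calc |∑ d ∈ lcmBox (↥H) D, ∑ d' ∈ lcmBox (↥H) D, (cc d d' * N d d' -
            if LcmCoprime W d d' then cc d d' * (x / (W * ∏ i, (Nat.lcm (d i) (d' i) : ℝ))) else 0)|
        ≤ ∑ d ∈ lcmBox (↥H) D, ∑ d' ∈ lcmBox (↥H) D, |cc d d' * N d d' -
            if LcmCoprime W d d' then cc d d' * (x / (W * ∏ i, (Nat.lcm (d i) (d' i) : ℝ))) else 0| := by
          refine (Finset.abs_sum_le_sum_abs _ _).trans (Finset.sum_le_sum fun d _ => ?_)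
          exact Finset.abs_sum_le_sum_abs _ _
      _ ≤ ∑ d ∈ lcmBox (↥H) D, ∑ d' ∈ lcmBox (↥H) D, 3 * ∏ i, (|a i (d i)| * |a' i (d' i)|) := by
          refine Finset.sum_le_sum fun d hd => Finset.sum_le_sum fun d' hd' => ?_
          have hcc : |cc d d'| = ∏ i, (|a i (d i)| * |a' i (d' i)|) := by
            rw [hccdef, Finset.abs_prod]
            exact Finset.prod_congr rfl fun i _ => abs_mul _ _
          rw [← hcc]
          split_ifs with hadm
          · rw [← mul_sub, abs_mul, mul_comm]
            exact mul_le_mul_of_nonneg_right (hNadm d hd d' hd' hadm) (abs_nonneg _)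
          · rw [hNzero d d' hadm, Nat.cast_zero, mul_zero, sub_zero, abs_zero]
            positivity
      _ = 3 * ((∏ i, ∑ e ∈ Finset.Icc 1 D, |a i e|) * ∏ i, ∑ e ∈ Finset.Icc 1 D, |a' i e|) := by
          rw [← sum_sum_prod_abs_mul_abs, Finset.mul_sum]
          simp_rw [Finset.mul_sum]
          rfl
      _ ≤ 3 * ((∏ i : ↥H, M * x ^ sF i) * ∏ i : ↥H, M * x ^ sG i) := by
          have hA : ∏ i, ∑ e ∈ Finset.Icc 1 D, |a i e| ≤ ∏ i : ↥H, M * x ^ sF i :=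
            Finset.prod_le_prod (fun i _ => Finset.sum_nonneg fun e _ => abs_nonneg _)
              fun i _ => sum_Icc_abs_moebius_mul_le hx1 hM0
                (fun t ht => hMF i i.2 t ⟨ht.1, ht.2.trans (hsF1 i i.2).le⟩) (hF i i.2).eq_zero D
          have hA' : ∏ i, ∑ e ∈ Finset.Icc 1 D, |a' i e| ≤ ∏ i : ↥H, M * x ^ sG i :=
            Finset.prod_le_prod (fun i _ => Finset.sum_nonneg fun e _ => abs_nonneg _)
              fun i _ => sum_Icc_abs_moebius_mul_le hx1 hM0
                (fun t ht => hMG i i.2 t ⟨ht.1, ht.2.trans (hsG1 i i.2).le⟩) (hG i i.2).eq_zero D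
          have h0 : 0 ≤ ∏ i, ∑ e ∈ Finset.Icc 1 D, |a' i e| :=
            Finset.prod_nonneg fun i _ => Finset.sum_nonneg fun e _ => abs_nonneg _
          have h0' : 0 ≤ ∏ i : ↥H, M * x ^ sF i := Finset.prod_nonneg fun i _ => by positivity
          exact mul_le_mul_of_nonneg_left (mul_le_mul hA hA' h0 h0') (by norm_num)
      _ = Cerr * x ^ σ := by
          simp only [Finset.prod_mul_distrib, Finset.prod_const, Finset.card_univ, Fintype.card_coe]
          rw [hCerr, hσdef, Finset.sum_add_distrib, Real.rpow_add (by linarith),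
            Real.rpow_sum_of_pos (by linarith), Real.rpow_sum_of_pos (by linarith),
            ← Finset.prod_coe_sort H (fun h => x ^ sF h), ← Finset.prod_coe_sort H (fun h => x ^ sG h)]
          ring
  -- Step 6: sizes
  have hWB : polymathB x ^ k * W ≤ Real.log x ^ (k + 2) := by
    calc polymathB x ^ k * W ≤ Real.log x ^ k * Real.log x ^ 2 :=
          mul_le_mul (pow_le_pow_left₀ hB.le (polymathB_le_log hx1.le) k) hxW hW.le
            (pow_nonneg hlog.le k)
      _ = Real.log x ^ (k + 2) := by ring
  have herr' : Cerr * x ^ σ ≤ ε / 2 * Mx := by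
    have hxσ : 0 < x ^ σ := Real.rpow_pos_of_pos (by linarith) σ
    have hx1σ : x ^ (1 - σ) * x ^ σ = x := by
      rw [← Real.rpow_add (by linarith), sub_add_cancel, Real.rpow_one]
    have hden : 0 < polymathB x ^ k * W := by positivity
    have key : (Cerr + 1) * x ^ σ * (polymathB x ^ k * W) ≤ ε / 2 * x := by
      calc (Cerr + 1) * x ^ σ * (polymathB x ^ k * W)
          ≤ (Cerr + 1) * x ^ σ * Real.log x ^ (k + 2) :=
            mul_le_mul_of_nonneg_left hWB (by positivity)
        _ = Real.log x ^ (k + 2) * (Cerr + 1) * x ^ σ := by ring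
        _ ≤ ε / 2 * x ^ (1 - σ) * x ^ σ := mul_le_mul_of_nonneg_right hxlittle hxσ.le
        _ = ε / 2 * x := by rw [mul_assoc, hx1σ]
    have h2 : Cerr * x ^ σ * (polymathB x ^ k * W) ≤ (Cerr + 1) * x ^ σ * (polymathB x ^ k * W) := by
      have : 0 ≤ x ^ σ * (polymathB x ^ k * W) := by positivity
      nlinarith
    rw [hMx, show ε / 2 * (x / (polymathB x ^ k * ↑W)) = (ε / 2 * x) / (polymathB x ^ k * ↑W) by ring,
      le_div_iff₀ hden]
    linarith
  -- Step 7: Lemma 4.1 at this `x`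
  have h41x : |lcmSum W (fun i : ↥H => F i) (fun i : ↥H => G i) x D -
      (∏ h ∈ H, ∫ t in (0 : ℝ)..1, deriv (F h) t * deriv (G h) t) * (polymathB x ^ k)⁻¹| ≤
      ε / 2 * (polymathB x ^ k)⁻¹ := by
    have := hx41
    rw [Real.rpow_one, hc, Real.norm_eq_abs, Real.norm_eq_abs, abs_of_pos (inv_pos.2 hBk)] at this
    exact this
  -- conclusion
  rw [Real.norm_eq_abs, Real.norm_eq_abs, abs_of_pos hMx0, hstep2]
  have hsplit : ∑ d ∈ lcmBox (↥H) D, ∑ d' ∈ lcmBox (↥H) D, cc d d' * N d d' -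
      (∏ h ∈ H, ∫ t in (0 : ℝ)..1, deriv (F h) t * deriv (G h) t) * Mx =
      (∑ d ∈ lcmBox (↥H) D, ∑ d' ∈ lcmBox (↥H) D, cc d d' * N d d' -
        x / W * lcmSum W (fun i : ↥H => F i) (fun i : ↥H => G i) x D) +
      x / W * (lcmSum W (fun i : ↥H => F i) (fun i : ↥H => G i) x D -
        (∏ h ∈ H, ∫ t in (0 : ℝ)..1, deriv (F h) t * deriv (G h) t) * (polymathB x ^ k)⁻¹) := by
    rw [hMx]; field_simp; ring
  rw [hsplit]
  calc _ ≤ |∑ d ∈ lcmBox (↥H) D, ∑ d' ∈ lcmBox (↥H) D, cc d d' * N d d' -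
          x / W * lcmSum W (fun i : ↥H => F i) (fun i : ↥H => G i) x D| +
        |x / W * (lcmSum W (fun i : ↥H => F i) (fun i : ↥H => G i) x D -
          (∏ h ∈ H, ∫ t in (0 : ℝ)..1, deriv (F h) t * deriv (G h) t) * (polymathB x ^ k)⁻¹)| :=
        abs_add_le _ _
    _ ≤ ε / 2 * Mx + ε / 2 * Mx := by
        refine add_le_add (herr.trans herr') ?_
        rw [abs_mul, abs_of_pos (by positivity : 0 < x / (W : ℝ))]
        calc x / W * |lcmSum W (fun i : ↥H => F i) (fun i : ↥H => G i) x D -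
              (∏ h ∈ H, ∫ t in (0 : ℝ)..1, deriv (F h) t * deriv (G h) t) * (polymathB x ^ k)⁻¹|
            ≤ x / W * (ε / 2 * (polymathB x ^ k)⁻¹) := mul_le_mul_of_nonneg_left h41x (by positivity)
          _ = ε / 2 * Mx := by rw [hMx]; field_simp
    _ = ε * Mx := by ring


end Literature.NumberTheory.Sieve
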